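import Literature.NumberTheory.GelbartRogawski1991.LocalKudlaSplittingUniqueness
import Literature.NumberTheory.GelbartRogawski1991.LocalDoubledUnitaryIwahori
import Literature.NumberTheory.GelbartRogawski1991.LocalDoubledUnitarySplitParabolic
import Literature.NumberTheory.Automorphic.UnitaryGroupLocalRankThreeCharactersDet
import Literature.NumberTheory.GelbartRogawski1991.CMSplittingCharLocalMu
import HarnessLib

/-!
# The local splitting DETERMINES the local character: `s_χ = s_χ′ ⇒ χ_v = χ′_v` (rank `3`, non-split place)

Topic `NumberTheory/GelbartRogawski1991`; namespace `Literature.NumberTheory.GelbartRogawski1991.UnitaryDualPair.LocalSplitting`.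
KERNEL ONLY: theorems; no definition, no named fact, no `sorry`.  Sequel of `LocalKudlaSplittingUniqueness` (§4 there:
`β' = β` on the doubled group as soon as the undoublings agree AND the determinants of `U(J) × 1` exhaust those of `H`):

* §1 `exists_inlLoc_det_eq_three` — in rank `n = 3` at a non-split place the determinant hypothesis holds for EVERY symmetric
  `T₀` with `det T₀` a unit: `det h` (`h ∈ H(F_v)`) has norm one and is the determinant of a quasi-reflection of `U(J)(F_v)`
  along an `F`-rational anisotropic vector (`UnitaryGroup.LocalRankThree.exists_refl_det_eq`, `exists_orthogonal_rows`);
* §2 `exists_isSiegelDelta_detDelta_eq` — for DIAGONAL `T₀` the Siegel Levi elements `m(diag d) = ofAdapted (diag d ⊕ diag (σ d)⁻¹)`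
  lie in `P_Δ(F_v)` with `det_Δ = ∏ dᵢ`: every unit of `E_w` is a `det_Δ p`, `p ∈ P_Δ(F_v)` (`exists_isSiegelDelta_detDelta_eq_unit`);
* §3 `eq_of_forall_chiDet_eq` — hence two character families with the same `χ_v ∘ det_Δ` on `P_Δ(F_v)` agree at the place
  `w ∣ v` (non-split `v`: one `w`);
* §4 **`localMu_eq_of_localSplittingCMWith_eq`** — for a CM field `L`, `T₀ = diagonal t` of rank `3`, two splitting characters
  `χ, χ'` (`IsSplittingChar L 1`) and a non-split `v`: if the undoubled CM local splittings coincide,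
  `localSplittingCMWith … χ … v μ = localSplittingCMWith … χ' … v μ`, then `localMu L χ v = localMu L χ' v` — Kudla's
  splitting `s_μ` DETERMINES `μ_v` ([GelbartRogawski1991, §3.1 Remark p. 457]: «a choice of `s` is equivalent to a choice of Hecke
  character»), the «`s_μ = s_μ′ ⇒ μ = μ′`» step of the `μ`-clause of [Liu2021, App. D Lem. D.1 (3)] (cell `hodgecm-mathlib`,
  line a4-liuD3, stubs :190/:195/:203).  The converse («`μ_v = μ′_v ⇒ s_μ = s_μ′` at `v`») is `LocalSplittingCMLocality`.

## References
* [GelbartRogawski1991] S. Gelbart, J. Rogawski, Invent. Math. 105 (1991), §3.1 Prop. 3.1.1 p. 455, Remark p. 457 L4–13.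
* [Kudla1994] S. Kudla, Israel J. Math. 87 (1994), §3, Thm. 3.1.  [HarrisKudlaSweet1996] §1 (1.11)–(1.16).
* [Dieudonne1971GroupesClassiques] J. Dieudonné, *La géométrie des groupes classiques* (1971), Chap. II §§4–5.
* [Liu2021] Y. Liu, Camb. J. Math. 9 (2021), App. D Lem. D.1 (3) (l. 5233).
-/

set_option autoImplicit false

noncomputable section

open NumberField IsDedekindDomain MeasureTheory Matrix
open Literature.RepresentationTheory.HeisenbergGroup
open Literature.NumberTheory.Automorphic Literature.NumberTheory.Automorphic.UnitaryGroup Literature.NumberTheory.Weil1964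
open Literature.NumberTheory.GelbartRogawski1991.AdaptedBlocks
open Literature.RepresentationTheory.HarrisKudlaSweet1996 Literature.NumberTheory.GaloisRepresentations

namespace Literature.NumberTheory.GelbartRogawski1991.UnitaryDualPair.LocalSplitting

variable (F : Type) [Field F] [NumberField F] (E : Type) [Field E] [NumberField E] [Algebra F E]
  [Algebra.IsQuadraticExtension F E] (c : E ≃ₐ[F] E)
  {δ : E} (hcδ : c δ = -δ) (hδ : δ ≠ 0) {d : F} (hd : δ * δ = algebraMap F E d)
  (v : HeightOneSpectrum (𝓞 F))

/-! ## §1 Rank `3`: the determinants of `U(J)(F_v) ⊕ 1` exhaust those of `H(F_v)` -/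

omit [Algebra.IsQuadraticExtension F E] in
/-- **`det (U(J)(F_v) ⊕ 1) ⊇ det H(F_v)` in rank `3` at a non-split place**: `det h` has norm one (`h` unitary for the doubled
form, whose determinant is a unit) and every norm-one scalar is the determinant of a quasi-reflection of `U(J)(F_v)` along an
`F`-rational anisotropic vector of `T₀` (`LocalRankThree.exists_refl_det_eq`); `det (g ⊕ 1) = det g`.
[cite: Dieudonne1971GroupesClassiques, Chap. II §4] -/
theorem exists_inlLoc_det_eq_three (hE : IsField (LocalRing E v)) {T₀ : Matrix (Fin 3) (Fin 3) F} (hT₀ : T₀.IsSymm)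
    (hT₀d : IsUnit T₀.det) {J : Matrix (Fin 3) (Fin 3) E} (hJ : J = T₀.map (algebraMap F E))
    {JD : Matrix (Fin (3 + 3)) (Fin (3 + 3)) E} (hJD : JD = (gramD F 3 T₀).map (algebraMap F E))
    (h : UnitaryGroup.localPi E c (3 + 3) JD v) :
    ∃ u : UnitaryGroup.localPi E c 3 J v,
      Matrix.GeneralLinearGroup.det
          ((UnitaryGroup.localPiEquiv E c (3 + 3) JD v (inlLoc F E c v 3 hJ hJD u) : UnitaryGroup.«local» E c (3 + 3) JD v) :
            GL (Fin (3 + 3)) (LocalRing E v)) =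
        Matrix.GeneralLinearGroup.det
          ((UnitaryGroup.localPiEquiv E c (3 + 3) JD v h : UnitaryGroup.«local» E c (3 + 3) JD v) :
            GL (Fin (3 + 3)) (LocalRing E v)) := by
  classical
  letI : Field (LocalRing E v) := hE.toField
  set ι : F →+* LocalRing E v := (algebraMap E (LocalRing E v)).comp (algebraMap F E) with hι
  -- `det h` has norm one
  have hH : (UnitaryGroup.adelicForm E (3 + 3) JD).map (adeleToLocal E v) = (gramD F 3 T₀).map ι := by
    rw [UnitaryGroup.adelicForm, hJD, Matrix.map_map, Matrix.map_map]
    rfl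
  have hJu : IsUnit ((UnitaryGroup.adelicForm E (3 + 3) JD).map (adeleToLocal E v)).det := by
    rw [hH, ← RingHom.mapMatrix_apply, ← RingHom.map_det]
    exact (isUnit_det_gramD F 3 hT₀d).map _
  have hnorm : conjLocal E c v
      ((UnitaryGroup.localPiEquiv E c (3 + 3) JD v h : UnitaryGroup.«local» E c (3 + 3) JD v) :
        GL (Fin (3 + 3)) (LocalRing E v)).1.det *
      ((UnitaryGroup.localPiEquiv E c (3 + 3) JD v h : UnitaryGroup.«local» E c (3 + 3) JD v) :
        GL (Fin (3 + 3)) (LocalRing E v)).1.det = 1 := by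
    have hg := mem_unitaryGroupOfForm_iff.1 (UnitaryGroup.localPiEquiv E c (3 + 3) JD v h).2
    have hd' := congrArg Matrix.det hg
    rw [Matrix.det_mul, Matrix.det_mul, Matrix.det_transpose, ← RingHom.mapMatrix_apply, ← RingHom.map_det] at hd'
    refine mul_right_cancel₀ hJu.ne_zero ?_
    rw [one_mul]
    linear_combination hd'
  -- a rational anisotropic vector and the quasi-reflection of determinant `det h`
  obtain ⟨b, cb, -, hcb, hbb, -, -⟩ := UnitaryGroup.exists_orthogonal_rows T₀ hT₀ hT₀d
  obtain ⟨g, -, hg⟩ :=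
    LocalRankThree.exists_refl_det_eq E c T₀ hT₀ hJ v hE (b 0) (by rw [hbb]; exact hcb 0) _ hnorm
  refine ⟨(UnitaryGroup.localPiEquiv E c 3 J v).symm g, Units.ext ?_⟩
  rw [Matrix.GeneralLinearGroup.val_det_apply, Matrix.GeneralLinearGroup.val_det_apply, localPiEquiv_inlLoc,
    (UnitaryGroup.localPiEquiv E c 3 J v).apply_symm_apply, coe_inlLocal, UnitaryGroup.coe_reindexGL,
    UnitaryGroup.coe_blockDiagGL, Units.val_one, Matrix.det_reindex_self, Matrix.det_fromBlocks_zero₂₁, Matrix.det_one,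
    mul_one, hg]

/-! ## §2 Siegel Levi elements with prescribed `det_Δ` (diagonal `T₀`) -/

section Levi

variable (n : ℕ) {T₀ : Matrix (Fin n) (Fin n) F} {JD : Matrix (Fin (n + n)) (Fin (n + n)) E}

omit [Algebra.IsQuadraticExtension F E] in
/-- `matW w p` is the `w`-component of the adapted-frame matrix `matA p`. [cite: Kudla1994, §3] -/
theorem matW_eq_matA_map (w : PlacesOver E v) (p : UnitaryGroup.localPi E c (n + n) JD v) :
    matW F E c v n w p = (matA F E c v n p).map (Pi.evalRingHom (fun w' : PlacesOver E v => w'.1.adicCompletion E) w) := by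
  rw [matW, matA, Matrix.reindex_apply, Matrix.reindex_apply, ← Matrix.submatrix_map, ← coe_component_eq_matS_map]

/-- `blkA` commutes with ring homomorphisms. [cite: Kudla1994, §3] -/
theorem blkA_map {L L' : Type*} [CommRing L] [CommRing L'] [Invertible (2 : L)] [Invertible (2 : L')] {ι : Type*}
    [Fintype ι] [DecidableEq ι] (f : L →+* L') (M : Matrix (ι ⊕ ι) (ι ⊕ ι) L) : blkA (M.map f) = (blkA M).map f := by
  have hf2 : f ⅟(2 : L) = ⅟(2 : L') :=
    (invOf_eq_right_inv (show (2 : L') * f ⅟(2 : L) = 1 by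
      rw [← map_ofNat f 2, ← map_mul, mul_invOf_self, map_one])).symm
  ext i j
  simp only [blkA, Matrix.map_apply, Matrix.smul_apply, Matrix.add_apply, Matrix.toBlocks₁₁, Matrix.toBlocks₁₂,
    Matrix.toBlocks₂₁, Matrix.toBlocks₂₂, Matrix.of_apply, smul_eq_mul, map_mul, map_add, hf2]

/-- `blkA M` is the upper-left block of `adapt M`. [cite: Kudla1994, §3] -/
theorem toBlocks₁₁_adapt {L : Type*} [CommRing L] [Invertible (2 : L)] {ι : Type*} [Fintype ι] [DecidableEq ι]
    (M : Matrix (ι ⊕ ι) (ι ⊕ ι) L) : (adapt M).toBlocks₁₁ = blkA M := by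
  rw [adapt_eq, Matrix.toBlocks_fromBlocks₁₁]

include hcδ hδ hd in
/-- **Siegel Levi elements**: for `T₀ = diagonal t` and units `d₁, …, dₙ` of `E ⊗ F_v`, the element
`m(d) := ofAdapted (diag d ⊕ diag (σ d)⁻¹)` lies in `P_Δ(F_v)` and `det_Δ m(d) = ∏ dᵢ` at every `w ∣ v`.
[cite: Kudla1994, §3] [cite: HarrisKudlaSweet1996, §1 (1.11), (1.15)] -/
theorem exists_isSiegelDelta_detDelta_eq (t : Fin n → F) (hT₀t : T₀ = Matrix.diagonal t) (hT₀ : T₀.IsSymm)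
    (hJD : JD = (gramD F n T₀).map (algebraMap F E)) (dd : Fin n → (LocalRing E v)ˣ) :
    ∃ p : UnitaryGroup.localPi E c (n + n) JD v, IsSiegelDelta F E c hcδ hδ hd v n hT₀ hJD p ∧
      ∀ w : PlacesOver E v, detDelta F E c v n w p = (∏ i, (dd i : LocalRing E v)) w := by
  classical
  subst hT₀t
  set σ := conjLocal E c v with hσdef
  have hσσ : ∀ x, σ (σ x) = x := conjLocal_conjLocal' F E c hcδ hδ hd v
  set A : Matrix (Fin n) (Fin n) (LocalRing E v) := Matrix.diagonal fun i => (dd i : LocalRing E v) with hA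
  set Dm : Matrix (Fin n) (Fin n) (LocalRing E v) := Matrix.diagonal fun i => σ ((dd i)⁻¹ : (LocalRing E v)ˣ) with hDm
  -- the form block `S = 2 · diag(t)` is diagonal and real
  set s : Fin n → LocalRing E v := fun i => (2 : LocalRing E v) * toLocalRing E v (algebraMap F _ (t i)) with hs
  have hS : (2 : LocalRing E v) • gramS F E v n (Matrix.diagonal t) = Matrix.diagonal s := by
    dsimp only [gramS]
    rw [Matrix.diagonal_map (map_zero _), Matrix.diagonal_map (map_zero _), ← Matrix.diagonal_smul]
    rfl
  have hY : ((Matrix.fromBlocks A 0 0 Dm).map σ)ᵀ * adForm F E v n (T₀ := Matrix.diagonal t) * Matrix.fromBlocks A 0 0 Dm =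
      adForm F E v n (T₀ := Matrix.diagonal t) := by
    dsimp only [adForm]
    rw [hS, Matrix.fromBlocks_map, Matrix.fromBlocks_transpose, hA, hDm, Matrix.diagonal_map (map_zero σ),
      Matrix.diagonal_map (map_zero σ), Matrix.diagonal_transpose, Matrix.diagonal_transpose,
      Matrix.map_zero σ (map_zero σ), Matrix.transpose_zero, Matrix.fromBlocks_multiply, Matrix.fromBlocks_multiply]
    simp only [Matrix.zero_mul, Matrix.mul_zero, add_zero, zero_add, Matrix.diagonal_mul_diagonal]
    refine Matrix.fromBlocks_inj.2 ⟨rfl, ?_, ?_, rfl⟩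
    · congr 1
      funext i
      rw [mul_right_comm, ← map_mul, Units.mul_inv, map_one, one_mul]
    · congr 1
      funext i
      rw [hσσ, mul_right_comm, Units.inv_mul, one_mul]
  have hYu : IsUnit (Matrix.fromBlocks A 0 0 Dm).det := by
    rw [Matrix.det_fromBlocks_zero₂₁, hA, hDm, Matrix.det_diagonal, Matrix.det_diagonal, ← map_prod σ, ← Units.coe_prod,
      ← Units.coe_prod]
    exact (Units.isUnit _).mul ((Units.isUnit _).map σ)
  refine ⟨ofAdapted F E c v n hJD _ hYu hY, isSiegelDelta_ofAdapted_fromBlocks F E c hcδ hδ hd v n hT₀ hJD A 0 Dm hYu hY,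
    fun w => ?_⟩
  rw [detDelta_eq_det_blkA F E c hcδ hδ hd v n hT₀ hJD
      (isSiegelDelta_ofAdapted_fromBlocks F E c hcδ hδ hd v n hT₀ hJD A 0 Dm hYu hY) w,
    matW_eq_matA_map, blkA_map, ← toBlocks₁₁_adapt, adapt_matA_ofAdapted, Matrix.toBlocks_fromBlocks₁₁, hA,
    Matrix.diagonal_map (map_zero _), Matrix.det_diagonal, Finset.prod_apply]
  rfl

/-- **every unit of `E_w` is a `det_Δ p`, `p ∈ P_Δ(F_v)`** (non-split `v`, diagonal `T₀`, `n ≥ 1`).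
[cite: Kudla1994, §3] [cite: HarrisKudlaSweet1996, §1 (1.15)] -/
theorem exists_isSiegelDelta_detDelta_eq_unit (hn : 0 < n) (t : Fin n → F) (hT₀t : T₀ = Matrix.diagonal t)
    (hT₀ : T₀.IsSymm) (hJD : JD = (gramD F n T₀).map (algebraMap F E)) (hc : c ≠ 1) (w : PlacesOver E v)
    (hw : c • w.1 = w.1) (a : (w.1.adicCompletion E)ˣ) :
    ∃ p : UnitaryGroup.localPi E c (n + n) JD v, IsSiegelDelta F E c hcδ hδ hd v n hT₀ hJD p ∧
      detDelta F E c v n w p = a := by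
  classical
  set α : (LocalRing E v)ˣ := Units.map (LocalRing.evalEquiv F E c v hc w hw).symm.toRingHom.toMonoidHom a with hα
  set dd : Fin n → (LocalRing E v)ˣ := fun i => if i = ⟨0, hn⟩ then α else 1 with hdd
  obtain ⟨p, hp, hdet⟩ := exists_isSiegelDelta_detDelta_eq F E c hcδ hδ hd v n t hT₀t hT₀ hJD dd
  refine ⟨p, hp, ?_⟩
  have hprod : (∏ i, (dd i : LocalRing E v)) = α := by
    rw [← Units.coe_prod]
    simp only [hdd, Fintype.prod_ite_eq']
  rw [hdet w, hprod, hα, Units.coe_map]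
  change (LocalRing.evalEquiv F E c v hc w hw) ((LocalRing.evalEquiv F E c v hc w hw).symm (a : w.1.adicCompletion E)) = a
  exact (LocalRing.evalEquiv F E c v hc w hw).apply_symm_apply _

end Levi

/-! ## §3 `χ_v ∘ det_Δ` on `P_Δ(F_v)` determines `χ_v` -/

section ReadOff

variable (n : ℕ) {T₀ : Matrix (Fin n) (Fin n) F} {JD : Matrix (Fin (n + n)) (Fin (n + n)) E}

/-- **two character families with the same `χ_v(det_Δ ·)` on `P_Δ(F_v)` agree at the place above a non-split `v`**
(diagonal `T₀`, `n ≥ 1`): every unit of `E_w` is a `det_Δ p` (§2). [cite: HarrisKudlaSweet1996, §1 (1.15)] -/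
theorem eq_of_forall_chiDet_eq (hn : 0 < n) (t : Fin n → F) (hT₀t : T₀ = Matrix.diagonal t) (hT₀ : T₀.IsSymm)
    (hJD : JD = (gramD F n T₀).map (algebraMap F E)) (hc : c ≠ 1) (w : PlacesOver E v) (hw : c • w.1 = w.1)
    (χv χv' : ∀ w' : PlacesOver E v, (w'.1.adicCompletion E)ˣ →* ℂˣ)
    (h : ∀ p : UnitaryGroup.localPi E c (n + n) JD v, IsSiegelDelta F E c hcδ hδ hd v n hT₀ hJD p →
      chiDet F E c v n χv' p = chiDet F E c v n χv p) :
    χv' w = χv w := by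
  classical
  haveI : Subsingleton (PlacesOver E v) := PlacesOver.subsingleton_of_smul_eq c hc w hw
  refine MonoidHom.ext fun a => ?_
  obtain ⟨p, hp, hdet⟩ := exists_isSiegelDelta_detDelta_eq_unit F E c hcδ hδ hd v n hn t hT₀t hT₀ hJD hc w hw a
  have hu : IsUnit (detDelta F E c v n w p) := by rw [hdet]; exact Units.isUnit a
  have hunit : hu.unit = a := Units.ext (by rw [IsUnit.unit_spec, hdet])
  have key := h p hp
  simp only [chiDet, Fintype.prod_subsingleton _ w, dif_pos hu, hunit] at key
  exact key

end ReadOff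

/-! ## §4 The CM datum: `s_χ = s_χ′ ⇒ μ_v(χ) = μ_v(χ′)` (rank `3`, non-split `v`, diagonal `T₀`) -/

section CM

/-- **The undoubled CM local splitting DETERMINES the local character** (rank `3`, `T₀ = diagonal t`, `v` non-split in the
CM field `L`): if `localSplittingCMWith … χ … v μ = localSplittingCMWith … χ' … v μ` for two splitting characters `χ, χ'`
(`IsSplittingChar L 1`), then `localMu L χ v = localMu L χ' v`.  Proof: the two doubled data are Kudla's non-split data
for the families `χ_w⁻¹`, `χ'_w⁻¹` with the SAME Leray section, so `β' = β` (`beta_eq_of_undoubleLoc_eq`, determinants by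
§1); on `P_Δ` both are `χ_v ∘ det_Δ` (`beta_parabolic`), whence `χ'_w = χ_w` (§3).  The «`s_μ = s_μ′ ⇒ μ_v = μ′_v`» step of
the `μ`-clause of [Liu2021, Lem. D.1 (3)]; the converse is `LocalSplittingCMLocality`.
[cite: GelbartRogawski1991, §3.1 Remark p. 457 L4–13] [cite: Kudla1994, Thm 3.1] [cite: Liu2021, App. D Lemma D.1 (3) (l. 5233)] -/
theorem localMu_eq_of_localSplittingCMWith_eq (L : Type) [Field L] [NumberField L] [IsCMField L]
    (t : Fin 3 → ↥(maximalRealSubfield L)) {T₀ : Matrix (Fin 3) (Fin 3) ↥(maximalRealSubfield L)}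
    (hT₀t : T₀ = Matrix.diagonal t) (hT₀ : T₀.IsSymm) (hT₀d : IsUnit T₀.det) {J : Matrix (Fin 3) (Fin 3) L}
    (hJ : J = T₀.map (algebraMap ↥(maximalRealSubfield L) L)) (χ χ' : HeckeCharacter L) (hχ : IsSplittingChar L 1 χ)
    (hχ' : IsSplittingChar L 1 χ') (v : HeightOneSpectrum (𝓞 ↥(maximalRealSubfield L)))
    [MeasurableSpace (v.adicCompletion ↥(maximalRealSubfield L))] [BorelSpace (v.adicCompletion ↥(maximalRealSubfield L))]
    (μ : Measure (v.adicCompletion ↥(maximalRealSubfield L))) [μ.IsAddHaarMeasure]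
    (w : PlacesOver L v) (hw : IsCMField.complexConj L • w.1 = w.1)
    (heq : localSplittingCMWith L 3 hT₀ hT₀d hJ χ hχ v μ = localSplittingCMWith L 3 hT₀ hT₀d hJ χ' hχ' v μ) :
    localMu L χ v = localMu L χ' v := by
  classical
  have hc : IsCMField.complexConj L ≠ 1 := IsCMField.complexConj_ne_one L
  haveI : Subsingleton (PlacesOver L v) := PlacesOver.subsingleton_of_smul_eq (IsCMField.complexConj L) hc w hw
  have hns : ¬ ∃ w' : PlacesOver L v, IsCMField.complexConj L • w'.1 ≠ w'.1 := by
    rintro ⟨w', hw'⟩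
    have e : w' = w := Subsingleton.elim w' w
    subst e
    exact hw' hw
  have hE : IsField (LocalRing L v) := LocalRing.isField_of_smul_eq (IsCMField.complexConj L) hc w hw
  set D := localSplittingDatumCM L v μ 3 hT₀ hT₀d rfl χ hχ with hDdef
  set D' := localSplittingDatumCM L v μ 3 hT₀ hT₀d rfl χ' hχ' with hD'def
  have hD : D = localSplittingDatumNonsplit (↥(maximalRealSubfield L)) L (IsCMField.complexConj L) (complexConj_imagUnit L)
      (imagUnit_ne_zero L) (imagUnit_mul_self L) v μ 3 hT₀ hT₀d rfl (Classical.choice (PlacesOver.nonempty L v))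
      (not_not.1 ((not_exists.1 hns) (Classical.choice (PlacesOver.nonempty L v))))
      (fun w' : PlacesOver L v => (χ.localComponent w'.1)⁻¹)
      (isEpsilonChar_localComponent_inv L v χ hχ (Classical.choice (PlacesOver.nonempty L v))
        (not_not.1 ((not_exists.1 hns) (Classical.choice (PlacesOver.nonempty L v)))))
      (isTrivialNearOne_localComponent_inv L v χ (Classical.choice (PlacesOver.nonempty L v))) := by
    rw [hDdef, localSplittingDatumCM, dif_neg hns]
  have hD' : D' = localSplittingDatumNonsplit (↥(maximalRealSubfield L)) L (IsCMField.complexConj L) (complexConj_imagUnit L)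
      (imagUnit_ne_zero L) (imagUnit_mul_self L) v μ 3 hT₀ hT₀d rfl (Classical.choice (PlacesOver.nonempty L v))
      (not_not.1 ((not_exists.1 hns) (Classical.choice (PlacesOver.nonempty L v))))
      (fun w' : PlacesOver L v => (χ'.localComponent w'.1)⁻¹)
      (isEpsilonChar_localComponent_inv L v χ' hχ' (Classical.choice (PlacesOver.nonempty L v))
        (not_not.1 ((not_exists.1 hns) (Classical.choice (PlacesOver.nonempty L v)))))
      (isTrivialNearOne_localComponent_inv L v χ' (Classical.choice (PlacesOver.nonempty L v))) := by
    rw [hD'def, localSplittingDatumCM, dif_neg hns]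
  -- the two data have the same Leray section (Rao's `L0D`)
  have hr : D'.r = D.r := by
    rw [hD, hD']
    rfl
  have heq' : undoubleLoc (↥(maximalRealSubfield L)) L (IsCMField.complexConj L) v 3 hJ rfl (complexConj_imagUnit L)
      (imagUnit_ne_zero L) (imagUnit_mul_self L) hT₀ hT₀d D.localSplitting D.proj_localSplitting =
      undoubleLoc (↥(maximalRealSubfield L)) L (IsCMField.complexConj L) v 3 hJ rfl (complexConj_imagUnit L)
      (imagUnit_ne_zero L) (imagUnit_mul_self L) hT₀ hT₀d D'.localSplitting D'.proj_localSplitting := heq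
  -- `β' = β` on the doubled group
  have hβ : ∀ h, D'.beta h = D.beta h :=
    beta_eq_of_undoubleLoc_eq (↥(maximalRealSubfield L)) L (IsCMField.complexConj L) (complexConj_imagUnit L)
      (imagUnit_ne_zero L) (imagUnit_mul_self L) v μ 3 hT₀ hT₀d hJ rfl (by norm_num) hE D D' hr heq'
      (exists_inlLoc_det_eq_three (↥(maximalRealSubfield L)) L (IsCMField.complexConj L) v hE hT₀ hT₀d hJ rfl)
  -- on `P_Δ`: `β = χ_v ∘ det_Δ`
  have hchi : ∀ p, IsSiegelDelta (↥(maximalRealSubfield L)) L (IsCMField.complexConj L) (complexConj_imagUnit L)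
      (imagUnit_ne_zero L) (imagUnit_mul_self L) v 3 hT₀ rfl p →
      chiDet (↥(maximalRealSubfield L)) L (IsCMField.complexConj L) v 3 (fun w' : PlacesOver L v => (χ'.localComponent w'.1)⁻¹) p =
        chiDet (↥(maximalRealSubfield L)) L (IsCMField.complexConj L) v 3 (fun w' : PlacesOver L v => (χ.localComponent w'.1)⁻¹) p := by
    intro p hp
    have e1 : D.beta p =
        chiDet (↥(maximalRealSubfield L)) L (IsCMField.complexConj L) v 3 (fun w' : PlacesOver L v => (χ.localComponent w'.1)⁻¹) p := by
      rw [hD]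
      exact beta_parabolic _ _ _ _ _ _ _ _ _ _ _ _ _ _ _ _ _ p hp
    have e2 : D'.beta p =
        chiDet (↥(maximalRealSubfield L)) L (IsCMField.complexConj L) v 3 (fun w' : PlacesOver L v => (χ'.localComponent w'.1)⁻¹) p := by
      rw [hD']
      exact beta_parabolic _ _ _ _ _ _ _ _ _ _ _ _ _ _ _ _ _ p hp
    rw [← e1, ← e2, hβ p]
  have hw' := eq_of_forall_chiDet_eq (↥(maximalRealSubfield L)) L (IsCMField.complexConj L) (complexConj_imagUnit L)
    (imagUnit_ne_zero L) (imagUnit_mul_self L) v 3 (by norm_num) t hT₀t hT₀ rfl hc w hw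
    (fun w' : PlacesOver L v => (χ.localComponent w'.1)⁻¹) (fun w' : PlacesOver L v => (χ'.localComponent w'.1)⁻¹) hchi
  have hcompw : χ.localComponent w.1 = χ'.localComponent w.1 := inv_injective hw'.symm
  rw [localMu, localMu, Fintype.prod_subsingleton _ w, Fintype.prod_subsingleton _ w, hcompw]

/-- the same for the Borel/`addHaar` Haar data of record (`localSplittingCM`, the local components of the tree's
`finLocalSplittingsCM` / `chiLocalSplittingsD`). [cite: GelbartRogawski1991, §3.1 Remark p. 457 L4–13] [cite: Kudla1994, Thm 3.1] -/
theorem localMu_eq_of_localSplittingCM_eq (L : Type) [Field L] [NumberField L] [IsCMField L]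
    (t : Fin 3 → ↥(maximalRealSubfield L)) {T₀ : Matrix (Fin 3) (Fin 3) ↥(maximalRealSubfield L)}
    (hT₀t : T₀ = Matrix.diagonal t) (hT₀ : T₀.IsSymm) (hT₀d : IsUnit T₀.det) {J : Matrix (Fin 3) (Fin 3) L}
    (hJ : J = T₀.map (algebraMap ↥(maximalRealSubfield L) L)) (χ χ' : HeckeCharacter L) (hχ : IsSplittingChar L 1 χ)
    (hχ' : IsSplittingChar L 1 χ') (v : HeightOneSpectrum (𝓞 ↥(maximalRealSubfield L)))
    (w : PlacesOver L v) (hw : IsCMField.complexConj L • w.1 = w.1)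
    (heq : localSplittingCM L 3 hT₀ hT₀d hJ χ hχ v = localSplittingCM L 3 hT₀ hT₀d hJ χ' hχ' v) :
    localMu L χ v = localMu L χ' v := by
  letI : MeasurableSpace (v.adicCompletion ↥(maximalRealSubfield L)) := borel _
  haveI : BorelSpace (v.adicCompletion ↥(maximalRealSubfield L)) := ⟨rfl⟩
  exact localMu_eq_of_localSplittingCMWith_eq L t hT₀t hT₀ hT₀d hJ χ χ' hχ hχ' v Measure.addHaar w hw heq

end CM

end Literature.NumberTheory.GelbartRogawski1991.UnitaryDualPair.LocalSplitting

end
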